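import Summits.QuantumFields.BalabanUV.Beta.CovariantTowerMatrix
import Summits.QuantumFields.BalabanUV.Beta.CovariantTowerCover
import Summits.QuantumFields.BalabanUV.Beta.CovariantTowerDecayTorus

/-!
# Beta / CovariantTowerLocal — LOCALITY and SIZE of the k-fold covariant tower operator Δ′ = Δ_U + Σ_{l≤k} a_l·G_lᵀG_l of
# the pv21 MODEL: ‖Δ′‖_{ℓ²} ≤ Λ_k, Δ′(p, q) = 0 unless dist(p, q) ≤ D_k := max(1, 2S_k), hence the FIRST EXPONENTIAL MOMENT
# Σ_q |(Δ′ − 1)(p, q)|·dist(p,q)·e^{κ·dist(p,q)} ≤ K₁(d, M, k, a, c_max, w_max, |Cp|, κ) on every torus, for every transport U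
# (unit `b2b-balaban-beta-d4-p2`, GEN 5; second module of `CovariantTowerMatrix → CovariantTowerLocal → CovariantTowerWRS →
# CovariantTowerRowData`; the datum `hK₁` of d4-p3's `UnitLatticeWalkInversion.walkInversion` for K′ := Δ′ − 1)

HONEST FRAMING: discharging `BetaPertH` makes Bałaban's UV stability UNCONDITIONAL — NOT the continuum limit, NOT the
Clay problem.  HONEST DEPENDENCY (verbatim): «continuum YM on T⁴ ⇐ BetaPertH ∧ nine spine estimates (0/9 proved);
BetaPertH ⇐ (D1) ∧ (D4) ∧ CAP+tail; G-an2-4 gates asym, D1 and NE2/3/4.»  THIS MODULE DISCHARGES NOTHING of `BetaPertH`,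
asserts NOTHING printed and cites nothing as a fact (ABSOLUTE RULE): [folklore] kernel theorems about the component MODEL of
the pv21 chain `Literature/…/Balaban1983to89/B9Thm37GlueTorusCov*` (model of [B9] = `Balaban1985BackgroundPropagators`,
Commun. Math. Phys. 99 (1985) 389–434, (3.16)/(3.23)–(3.24): a finite-range operator — ∇_U\*∇_U has range one bond, the
level-l averaging term couples only sites of one level-l block).

CONTENT.
* §1 `l2Bound_towerOp`: ‖Δ′‖_{ℓ²} ≤ 4c_max²z + Σ_l a_l·w_max²·N_l (abstract tower; `CovariantTowerL2` BY NAME).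
* §2 torus: `rangeTower d M k = max 1 (2S_k)`; `covD_apply_eq_zero_of_vanish`, `towerOp_apply_eq_zero_of_far` (Δ′f(p) = 0
  when f vanishes on the D_k-ball of p), `towerOp_single_eq_zero_of_far` (the entries), `towerLambda`,
  `l2Bound_towerOp_torus`.
* §3 `momentConst`, **`firstMoment_towerOp_le`**: Σ_q ‖(cmat Δ′ − 1)(p,q)‖·dist·e^{κ·dist} ≤ K₁ — volume-free, U-free.
NOT HERE: the walk inversion (sibling `CovariantTowerWRS`).  Row D4: RECORDS value; class of (T3)/NODE O.2 unchanged;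
D4 DISCHARGE NO DATE; NOT BetaPertH, NOT continuum, NOT Clay.
-/

namespace Summit.QuantumFields.BalabanUV.Beta.CovariantTowerLocal

open Finset
open Literature.MathematicalPhysics.QuantumFieldTheory.Balaban1983to89
open B9Thm37Sum B9Thm37Glue B9Thm37GluePU B9Thm37GlueTorusInv B9Thm37GlueTorusCov B9Thm37GlueTorusCovComp
open B9Thm37GlueTorusCovPoinc (tdepth_le card_block_le)
open B9Thm37GlueTorusCovLevels B9Thm37GlueTorusCovTower
open B9Thm37GlueTorusCovCT (card_filter_bsrc_le card_filter_btgt_le)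
open Summit.QuantumFields.BalabanUV.Beta.CovariantTowerL2
open Summit.QuantumFields.BalabanUV.Beta.CovariantTowerDecay (towerS)
open Summit.QuantumFields.BalabanUV.Beta.CovariantTowerDecayTorus (towerS_mono)
open Summit.QuantumFields.BalabanUV.Beta.CovariantTowerCover (dist_le_of_towerBlk_eq)
open Summit.QuantumFields.BalabanUV.Beta.CovariantTowerMatrix
open B5TorusCover (UT Ctr ctrU)
open B5Leibniz121 (up dist_up_le)

noncomputable section

/-! ## §1  The ℓ² size of the tower operator (abstract tower) -/

section Abstract

variable {St Bd Cp : Type} [Fintype St] [DecidableEq St] [Fintype Bd] [Fintype Cp] [DecidableEq Cp]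
  {src tgt : Bd → St} {Bs : ℕ → Type} [∀ j, Fintype (Bs j)] [∀ j, DecidableEq (Bs j)]
  (Ks : ∀ j, Comb src tgt (Bs j)) (Rm : Bd → Cp → Cp → ℝ)

omit [∀ j, Fintype (Bs j)] in
/-- **‖Δ_U + Σ_{l≤k} a_lG_lᵀG_l‖_{ℓ²} ≤ 4c_max²z + Σ_l a_l·w_max²·N_l** (isometric bond matrices, |c| ≤ c_max, bond degrees
≤ z, SITE weights |W_l| ≤ w_max, a_l ≥ 0, level-l blocks of ≤ N_l = `towerN n l` sites). [folklore] -/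
theorem l2Bound_towerOp (hRm : ∀ b i j, ∑ k, Rm b k i * Rm b k j = if i = j then (1 : ℝ) else 0)
    {c : Bd → ℝ} {cmax : ℝ} (hcmax : 0 ≤ cmax) (hc' : ∀ b, |c b| ≤ cmax) {z : ℕ}
    (hzs : ∀ x, (univ.filter fun b => src b = x).card ≤ z) (hzt : ∀ x, (univ.filter fun b => tgt b = x).card ≤ z)
    {n : ℕ → ℕ} (hn : ∀ j β, (univ.filter fun x => (Ks j).blk x = β).card ≤ n j) (k : ℕ)
    {W : Fin (k + 1) → St → ℝ} {wmax : ℝ} (hwmax : 0 ≤ wmax) (hW : ∀ l x, |W l x| ≤ wmax)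
    {a : Fin (k + 1) → ℝ} (ha : ∀ l, 0 ≤ a l) :
    L2Bound (towerOp Ks Rm c k W a)
      (4 * cmax ^ 2 * z + ∑ l : Fin (k + 1), a l * (wmax ^ 2 * (towerN n l : ℝ))) := by
  have h1 : L2Bound (covDT src tgt c Rm ∘ₗ covD src tgt c Rm) ((2 * cmax * Real.sqrt z) * (2 * cmax * Real.sqrt z)) :=
    (l2Bound_covDT src tgt c Rm hRm hcmax hc' hzs hzt).comp (l2Bound_covD src tgt c Rm hRm hcmax hc' hzs hzt)
  have h2 : ∀ l : Fin (k + 1), L2Bound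
      (a l • (gMeanT (towerBlk Ks (l : ℕ)) (W l) (towerTr Ks Rm (l : ℕ)) ∘ₗ
        gMean (towerBlk Ks (l : ℕ)) (W l) (towerTr Ks Rm (l : ℕ))))
      (|a l| * ((wmax * Real.sqrt (towerN n l)) * (wmax * Real.sqrt (towerN n l)))) := fun l =>
    ((l2Bound_gMeanT (towerBlk Ks (l : ℕ)) (W l) (towerTr Ks Rm (l : ℕ)) hwmax (hW l)
        (towerTr_orth Ks Rm hRm (l : ℕ)) (card_towerBlk_fibre_le Ks hn (l : ℕ))).comp
      (l2Bound_gMean (towerBlk Ks (l : ℕ)) (W l) (towerTr Ks Rm (l : ℕ)) hwmax (hW l)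
        (towerTr_orth Ks Rm hRm (l : ℕ)) (card_towerBlk_fibre_le Ks hn (l : ℕ)))).smul (a l)
  have h3 := L2Bound.sum univ (fun l _ => h2 l)
  have h := h1.add h3
  refine (h.of_eq rfl).mono (le_of_eq ?_)
  have hz : Real.sqrt z * Real.sqrt z = z := Real.mul_self_sqrt (Nat.cast_nonneg z)
  have hN : ∀ l : Fin (k + 1), Real.sqrt (towerN n l) * Real.sqrt (towerN n l) = (towerN n l : ℝ) := fun l =>
    Real.mul_self_sqrt (Nat.cast_nonneg _)
  have e1 : (2 * cmax * Real.sqrt z) * (2 * cmax * Real.sqrt z) = 4 * cmax ^ 2 * (Real.sqrt z * Real.sqrt z) := by ring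
  rw [e1, hz]
  congr 1
  refine Finset.sum_congr rfl fun l _ => ?_
  calc |a l| * (wmax * Real.sqrt (towerN n l) * (wmax * Real.sqrt (towerN n l)))
      = a l * (wmax ^ 2 * (Real.sqrt (towerN n l) * Real.sqrt (towerN n l))) := by rw [abs_of_nonneg (ha l)]; ring
    _ = a l * (wmax ^ 2 * (towerN n l : ℝ)) := by rw [hN l]

end Abstract

/-! ## §2  The torus: finite range -/

section Torus

variable {d : ℕ} {N : Fin d → ℕ} [∀ i, NeZero (N i)] [NeZero d]

/-- MODEL bookkeeping: **the range of the tower operator**, D_k = max(1, 2S_k), S_k = `towerS (j ↦ d(M_j − 1)) k`. [folklore] -/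
def rangeTower (d : ℕ) (M : ℕ → ℕ) (k : ℕ) : ℝ := max 1 (2 * (towerS (fun j => d * (M j - 1)) k : ℝ))

/-- D_k ≥ 1. [folklore] -/
theorem one_le_rangeTower (d : ℕ) (M : ℕ → ℕ) (k : ℕ) : 1 ≤ rangeTower d M k := le_max_left _ _

/-- D_k ≥ 0. [folklore] -/
theorem rangeTower_nonneg (d : ℕ) (M : ℕ → ℕ) (k : ℕ) : 0 ≤ rangeTower d M k :=
  zero_le_one.trans (one_le_rangeTower d M k)

omit [NeZero d] in
/-- A nearest-neighbour bond of the torus has length ≤ 1. [folklore] -/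
theorem dist_bsrc_btgt_le (b : UT N × Fin d) : dist (bsrc b) (btgt b) ≤ 1 := by
  obtain ⟨y, μ⟩ := b
  exact dist_up_le y μ

omit [NeZero d] in
/-- ∇_U of a field vanishing at both ends of a bond vanishes on that bond. [folklore] -/
theorem covD_apply_eq_zero_of_vanish {Cp : Type} [Fintype Cp] (c : UT N × Fin d → ℝ)
    (Rm : UT N × Fin d → Cp → Cp → ℝ) (f : UT N × Cp → ℝ) (b : UT N × Fin d)
    (hs : ∀ j, f (bsrc b, j) = 0) (ht : ∀ j, f (btgt b, j) = 0) (i : Cp) :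
    covD bsrc btgt c Rm f (b, i) = 0 := by
  rw [covD_apply]
  simp only [ht, hs, mul_zero, Finset.sum_const_zero, sub_zero]

/-- Two sites of one level-l tower block (l ≤ k) are within D_k. [folklore] -/
theorem dist_le_rangeTower_of_towerBlk_eq {M : ℕ → ℕ} (hM : ∀ j, 1 ≤ M j) (hdiv : ∀ j i, M j ∣ N i) (k : ℕ)
    (l : Fin (k + 1)) {x y : UT N}
    (h : towerBlk (torusTower hM hdiv) (l : ℕ) x = towerBlk (torusTower hM hdiv) (l : ℕ) y) :
    dist x y ≤ rangeTower d M k := by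
  have h1 := dist_le_of_towerBlk_eq hM hdiv (l : ℕ) h
  have h2 : (towerS (fun j => d * (M j - 1)) (l : ℕ) : ℝ) ≤ towerS (fun j => d * (M j - 1)) k := by
    exact_mod_cast towerS_mono _ (Nat.lt_succ_iff.mp l.2)
  calc dist x y ≤ 2 * (towerS (fun j => d * (M j - 1)) (l : ℕ) : ℝ) := h1
    _ ≤ 2 * (towerS (fun j => d * (M j - 1)) k : ℝ) := by linarith
    _ ≤ rangeTower d M k := le_max_right _ _

/-- **FINITE RANGE OF THE TOWER OPERATOR**: if f vanishes on the D_k-ball about the site of p then (Δ′f)(p) = 0 — ∇_U\*∇_U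
sees only the bonds at p (length ≤ 1 ≤ D_k) and the level-l term a_lG_lᵀG_l only the level-l block of p (diameter
≤ 2S_l ≤ D_k); every transport, all weights. [folklore] -/
theorem towerOp_apply_eq_zero_of_far {Cp : Type} [Fintype Cp] [DecidableEq Cp] {M : ℕ → ℕ} (hM : ∀ j, 1 ≤ M j)
    (hdiv : ∀ j i, M j ∣ N i) (c : UT N × Fin d → ℝ) (Rm : UT N × Fin d → Cp → Cp → ℝ) (k : ℕ)
    (W : Fin (k + 1) → UT N → ℝ) (a : Fin (k + 1) → ℝ) (f : UT N × Cp → ℝ) (p : UT N × Cp)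
    (hf : ∀ q : UT N × Cp, dist p.1 q.1 ≤ rangeTower d M k → f q = 0) :
    towerOp (torusTower hM hdiv) Rm c k W a f p = 0 := by
  have h1 : ∀ y, dist p.1 y ≤ 1 → ∀ j, f (y, j) = 0 := fun y hy j =>
    hf (y, j) (hy.trans (one_le_rangeTower d M k))
  -- ∇_U f vanishes on every bond touching the site of p
  have hbond : ∀ b : UT N × Fin d, (btgt b = p.1 ∨ bsrc b = p.1) → ∀ i, covD bsrc btgt c Rm f (b, i) = 0 := by
    intro b hb i
    refine covD_apply_eq_zero_of_vanish c Rm f b (fun j => h1 _ ?_ j) (fun j => h1 _ ?_ j) i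
    · rcases hb with h | h
      · rw [← h, dist_comm]; exact dist_bsrc_btgt_le b
      · rw [← h, dist_self]; exact zero_le_one
    · rcases hb with h | h
      · rw [← h, dist_self]; exact zero_le_one
      · rw [← h]; exact dist_bsrc_btgt_le b
  have hD : covDT bsrc btgt c Rm (covD bsrc btgt c Rm f) p = 0 := by
    rw [covDT_apply]
    refine Finset.sum_eq_zero fun b _ => ?_
    by_cases hb : btgt b = p.1 ∨ bsrc b = p.1
    · simp only [hbond b hb, mul_zero, Finset.sum_const_zero, sub_zero]
    · obtain ⟨hb1, hb2⟩ := not_or.mp hb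
      simp only [hb1, hb2, if_false, zero_mul, sub_zero]
  -- the level sums see only the blocks of p
  have hG : ∀ (l : Fin (k + 1)) (i : Cp),
      gMean (towerBlk (torusTower hM hdiv) (l : ℕ)) (W l) (towerTr (torusTower hM hdiv) Rm (l : ℕ)) f
        (towerBlk (torusTower hM hdiv) (l : ℕ) p.1, i) = 0 := by
    intro l i
    rw [gMean_apply]
    refine Finset.sum_eq_zero fun y _ => ?_
    split_ifs with hy
    · have hfy : ∀ j, f (y, j) = 0 := fun j =>
        hf (y, j) (dist_le_rangeTower_of_towerBlk_eq hM hdiv k l hy.symm)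
      simp only [hfy, mul_zero, Finset.sum_const_zero]
    · rfl
  have hL : levelSum (fun l : Fin (k + 1) => towerBlk (torusTower hM hdiv) (l : ℕ)) W
      (fun l => towerTr (torusTower hM hdiv) Rm (l : ℕ)) a f p = 0 := by
    rw [levelSum_apply]
    refine Finset.sum_eq_zero fun l _ => ?_
    rw [gMeanT_apply]
    simp only [hG l, mul_zero, Finset.sum_const_zero]
  show (covDT bsrc btgt c Rm ∘ₗ covD bsrc btgt c Rm +
      levelSum (fun l : Fin (k + 1) => towerBlk (torusTower hM hdiv) (l : ℕ)) W
        (fun l => towerTr (torusTower hM hdiv) Rm (l : ℕ)) a) f p = 0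
  rw [LinearMap.add_apply, Pi.add_apply, LinearMap.comp_apply, hD, hL, add_zero]

/-- **The entries**: Δ′(δ_q)(p) = 0 whenever dist(p, q) > D_k. [folklore] -/
theorem towerOp_single_eq_zero_of_far {Cp : Type} [Fintype Cp] [DecidableEq Cp] {M : ℕ → ℕ} (hM : ∀ j, 1 ≤ M j)
    (hdiv : ∀ j i, M j ∣ N i) (c : UT N × Fin d → ℝ) (Rm : UT N × Fin d → Cp → Cp → ℝ) (k : ℕ)
    (W : Fin (k + 1) → UT N → ℝ) (a : Fin (k + 1) → ℝ) (p q : UT N × Cp) (r : ℝ)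
    (hfar : rangeTower d M k < dist p.1 q.1) :
    towerOp (torusTower hM hdiv) Rm c k W a (Pi.single q r) p = 0 := by
  refine towerOp_apply_eq_zero_of_far hM hdiv c Rm k W a _ p fun q' hq' => ?_
  have hne : q' ≠ q := fun h => by rw [h] at hq'; exact absurd hq' (not_le.mpr hfar)
  rw [Pi.single_apply, if_neg hne]

/-- MODEL bookkeeping: **the ℓ² size constant of the torus tower**, Λ_k = 4c_max²d + Σ_l a_l·w_max²·N_l,
N_l = `towerN (j ↦ M_j^d) l`. [folklore] -/
def towerLambda (d : ℕ) (M : ℕ → ℕ) (cmax wmax : ℝ) (k : ℕ) (a : Fin (k + 1) → ℝ) : ℝ :=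
  4 * cmax ^ 2 * d + ∑ l : Fin (k + 1), a l * (wmax ^ 2 * (towerN (fun j => M j ^ d) l : ℝ))

/-- **‖Δ′‖_{ℓ²} ≤ Λ_k on the torus** (every isometric transport, SITE weights |W_l| ≤ w_max, a_l ≥ 0). [folklore] -/
theorem l2Bound_towerOp_torus {Cp : Type} [Fintype Cp] [DecidableEq Cp] {M : ℕ → ℕ} (hM : ∀ j, 1 ≤ M j)
    (hdiv : ∀ j i, M j ∣ N i) (c : UT N × Fin d → ℝ) {cmax : ℝ} (hcmax : 0 ≤ cmax) (hc' : ∀ b, |c b| ≤ cmax)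
    (Rm : UT N × Fin d → Cp → Cp → ℝ) (hRm : ∀ b i j, ∑ k, Rm b k i * Rm b k j = if i = j then (1 : ℝ) else 0)
    (k : ℕ) {W : Fin (k + 1) → UT N → ℝ} {wmax : ℝ} (hwmax : 0 ≤ wmax) (hW : ∀ l x, |W l x| ≤ wmax)
    {a : Fin (k + 1) → ℝ} (ha : ∀ l, 0 ≤ a l) :
    L2Bound (towerOp (torusTower hM hdiv) Rm c k W a) (towerLambda d M cmax wmax k a) :=
  l2Bound_towerOp (torusTower hM hdiv) Rm hRm hcmax hc' card_filter_bsrc_le card_filter_btgt_le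
    (fun j β => card_block_le (hM j) (hdiv j) β) k hwmax hW ha

/-! ## §3  The first exponential moment of K′ = Δ′ − 1 -/

/-- MODEL bookkeeping: **the first-moment constant**, K₁ = Λ_k·(n_C·(2D_k + 1)^d)·D_k·e^{κD_k}. [folklore] -/
def momentConst (d : ℕ) (M : ℕ → ℕ) (cmax wmax : ℝ) (k : ℕ) (a : Fin (k + 1) → ℝ) (nC : ℕ) (κ : ℝ) : ℝ :=
  towerLambda d M cmax wmax k a * ((nC : ℝ) * (2 * rangeTower d M k + 1) ^ d) *
    (rangeTower d M k * Real.exp (κ * rangeTower d M k))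

omit [NeZero d] in
/-- The number of torus sites within r of a site is ≤ (2r + 1)^d (b05 `ballCard_le_real`). [folklore] -/
theorem card_ball_le (x : UT N) {r : ℝ} (hr : 0 ≤ r) :
    ((univ.filter fun y : UT N => dist x y ≤ r).card : ℝ) ≤ (2 * r + 1) ^ d := by
  have h := B5TorusCover.ballCard_le_real (UT.one_le N) (UT.toSite N x) hr
  have hfl : (2 * (⌊r⌋₊ : ℝ) + 1) ^ d ≤ (2 * r + 1) ^ d :=
    pow_le_pow_left₀ (by positivity) (by linarith [Nat.floor_le hr]) d
  exact le_trans (by exact_mod_cast h) hfl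

/-- **THE FIRST EXPONENTIAL MOMENT OF K′ = Δ′ − 1 IS VOLUME-FREE AND U-FREE**: for every κ ≥ 0 and every p,
Σ_q ‖(cmat Δ′ − 1)(p, q)‖·dist(p, q)·e^{κ·dist(p, q)} ≤ K₁ = `momentConst d M c_max w_max k a |Cp| κ` — the diagonal drops out
(dist = 0), the off-diagonal entries are those of Δ′, bounded by Λ_k and vanishing beyond D_k, and a D_k-ball holds
≤ |Cp|(2D_k + 1)^d points. [folklore] -/
theorem firstMoment_towerOp_le {Cp : Type} [Fintype Cp] [DecidableEq Cp] {M : ℕ → ℕ} (hM : ∀ j, 1 ≤ M j)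
    (hdiv : ∀ j i, M j ∣ N i) (c : UT N × Fin d → ℝ) {cmax : ℝ} (hcmax : 0 ≤ cmax) (hc' : ∀ b, |c b| ≤ cmax)
    (Rm : UT N × Fin d → Cp → Cp → ℝ) (hRm : ∀ b i j, ∑ k, Rm b k i * Rm b k j = if i = j then (1 : ℝ) else 0)
    (k : ℕ) {W : Fin (k + 1) → UT N → ℝ} {wmax : ℝ} (hwmax : 0 ≤ wmax) (hW : ∀ l x, |W l x| ≤ wmax)
    {a : Fin (k + 1) → ℝ} (ha : ∀ l, 0 ≤ a l) {κ : ℝ} (hκ : 0 ≤ κ) (p : UT N × Cp) :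
    ∑ q, ‖(cmat (towerOp (torusTower hM hdiv) Rm c k W a) - 1) p q‖ * dist p.1 q.1 *
        Real.exp (κ * dist p.1 q.1) ≤ momentConst d M cmax wmax k a (Fintype.card Cp) κ := by
  set Δ' := towerOp (torusTower hM hdiv) Rm c k W a with hΔ
  set D := rangeTower d M k with hDdef
  set Λ := towerLambda d M cmax wmax k a with hΛdef
  have hΛ : L2Bound Δ' Λ := l2Bound_towerOp_torus hM hdiv c hcmax hc' Rm hRm k hwmax hW ha
  have hΛ0 : 0 ≤ Λ := hΛ.1
  have hD0 : 0 ≤ D := rangeTower_nonneg d M k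
  have hB0 : 0 ≤ Λ * (D * Real.exp (κ * D)) := by positivity
  -- termwise bound by the indicator of the D-ball
  have hterm : ∀ q : UT N × Cp, ‖(cmat Δ' - 1) p q‖ * dist p.1 q.1 * Real.exp (κ * dist p.1 q.1) ≤
      (if dist p.1 q.1 ≤ D then (1 : ℝ) else 0) * (Λ * (D * Real.exp (κ * D))) := by
    intro q
    have hR : 0 ≤ (if dist p.1 q.1 ≤ D then (1 : ℝ) else 0) * (Λ * (D * Real.exp (κ * D))) := by
      split_ifs
      · exact mul_nonneg zero_le_one hB0
      · exact le_of_eq (zero_mul _).symm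
    by_cases h0 : dist p.1 q.1 = 0
    · have hl : ‖(cmat Δ' - 1) p q‖ * dist p.1 q.1 * Real.exp (κ * dist p.1 q.1) = 0 := by
        rw [h0, mul_zero, zero_mul]
      rw [hl]; exact hR
    have hpq : p ≠ q := fun h => h0 (by rw [h, dist_self])
    have hoff : (cmat Δ' - 1) p q = cmat Δ' p q := by
      rw [Matrix.sub_apply, Matrix.one_apply_ne hpq, sub_zero]
    by_cases hfar : D < dist p.1 q.1
    · have hz : cmat Δ' p q = 0 := by
        rw [cmat_apply, towerOp_single_eq_zero_of_far hM hdiv c Rm k W a p q 1 hfar, Complex.ofReal_zero]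
      rw [hoff, hz, norm_zero, zero_mul, zero_mul]; exact hR
    · replace hfar : dist p.1 q.1 ≤ D := not_lt.mp hfar
      rw [if_pos hfar, one_mul, hoff]
      have hn : ‖cmat Δ' p q‖ ≤ Λ := norm_cmat_le_of_l2Bound hΛ p q
      have he : Real.exp (κ * dist p.1 q.1) ≤ Real.exp (κ * D) :=
        Real.exp_le_exp.mpr (mul_le_mul_of_nonneg_left hfar hκ)
      calc ‖cmat Δ' p q‖ * dist p.1 q.1 * Real.exp (κ * dist p.1 q.1)
          ≤ Λ * D * Real.exp (κ * D) :=
            mul_le_mul (mul_le_mul hn hfar dist_nonneg hΛ0) he (Real.exp_pos _).le (mul_nonneg hΛ0 hD0)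
        _ = Λ * (D * Real.exp (κ * D)) := by ring
  -- the number of points in the D-ball
  have hcount : ∑ q : UT N × Cp, (if dist p.1 q.1 ≤ D then (1 : ℝ) else 0) ≤
      (Fintype.card Cp : ℝ) * (2 * D + 1) ^ d := by
    have hball := card_ball_le (N := N) p.1 hD0
    calc ∑ q : UT N × Cp, (if dist p.1 q.1 ≤ D then (1 : ℝ) else 0)
        = ∑ y : UT N, ∑ _j : Cp, (if dist p.1 y ≤ D then (1 : ℝ) else 0) := Fintype.sum_prod_type _
      _ = ∑ y : UT N, (Fintype.card Cp : ℝ) * (if dist p.1 y ≤ D then (1 : ℝ) else 0) :=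
          Finset.sum_congr rfl fun y _ => by rw [Finset.sum_const, Finset.card_univ, nsmul_eq_mul]
      _ = (Fintype.card Cp : ℝ) * ((univ.filter fun y : UT N => dist p.1 y ≤ D).card : ℝ) := by
          rw [← Finset.mul_sum, Finset.sum_boole]
      _ ≤ (Fintype.card Cp : ℝ) * (2 * D + 1) ^ d := mul_le_mul_of_nonneg_left hball (Nat.cast_nonneg _)
  calc ∑ q, ‖(cmat Δ' - 1) p q‖ * dist p.1 q.1 * Real.exp (κ * dist p.1 q.1)
      ≤ ∑ q : UT N × Cp, (if dist p.1 q.1 ≤ D then (1 : ℝ) else 0) * (Λ * (D * Real.exp (κ * D))) :=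
        Finset.sum_le_sum fun q _ => hterm q
    _ = (∑ q : UT N × Cp, (if dist p.1 q.1 ≤ D then (1 : ℝ) else 0)) * (Λ * (D * Real.exp (κ * D))) := by
        rw [Finset.sum_mul]
    _ ≤ ((Fintype.card Cp : ℝ) * (2 * D + 1) ^ d) * (Λ * (D * Real.exp (κ * D))) :=
        mul_le_mul_of_nonneg_right hcount hB0
    _ = momentConst d M cmax wmax k a (Fintype.card Cp) κ := by
        rw [momentConst, ← hDdef, ← hΛdef]; ring

end Torus

end

end Summit.QuantumFields.BalabanUV.Beta.CovariantTowerLocal
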